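import Summits.QuantumAdvantage.QuantumAdvantage.Theses.ArithStatLadder
import Literature.Computability.Cryptography.HallgrenClassGroup
import Literature.Computability.Complexity.CircuitClassesUniformProofs
import Literature.Computability.Complexity.PPolyReductions
import Literature.Computability.Complexity.PPolyTuringClosure
import Literature.Computability.Complexity.Space
import Literature.Computability.AlgebraicComplexity.BurgisserThm41Proofs
import Literature.Computability.QuantumComplexity.FactoringPrimesProofs
import Literature.Barriers.QuantumAdvantage.NaturalProofs
import Literature.Barriers.PneNP.NaturalProofs

/-!
# `IqThreeNotPPoly` (stmt-QuantumAdvantage-2422) — the shape of a refutation and the cost of a proof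

Negative-side lemmas for the crux `ArithStatLadder.IqThreeNotPPoly` (`IQ3 ∉ P/poly`, IQ3 = binary
codes of the `d` with `−d` a fundamental discriminant and `3 ∣ h(−d)`), extracted from the refuter
work file `Summits/QuantumAdvantage/QuantumAdvantage/Cruxes/IqThreeNotPPoly/Disproof.lean`
(refuter-cdisprove-stmt-QuantumAdvantage-2422-0, cycle 1) so that planners and provers can import
them. Sorry-free; axioms ⊆ {propext, Classical.choice, Quot.sound}. No statement of the route is
asserted positively.

* READING: the crux is literally `bin S ∉ P/poly`, `S = {d | IsNegFundamentalDiscr d ∧ 3 ∣ h(−d)}`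
  (`iqThreeNotPPoly_iff`, `Iff.rfl`); its negation is literally an explicit polynomial-size
  `B₂`-circuit family deciding `bin S` on every word (`not_iqThreeNotPPoly_iff_exists`) — i.e. a
  classical non-uniform polynomial algorithm for "`3 ∣ h(−d)`" on fundamental discriminants, which is
  not in print (best: the whole class group in expected time `L_d(1/2)` under GRH, Hafner–McCurley
  1989); the language is nontrivial (`h(−19) = 1`, `h(−31) = 3`: `19 ∉ S`, `31 ∈ S`, both 5-bit).
* COST OF THE POSITIVE SIDE (why the crux is hypothesis-type): `IqThreeNotPPoly` gives `IQ3 ∉ BPP`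
  and `IQ3 ∉ P` (tree theorems `BPP ⊆ P/poly`, `P ⊆ P/poly`), hence `PSPACE ⊄ P/poly` as soon as the
  folklore `IQ3 ∈ PSPACE` is supplied; and under the Razborov–Rudich fact with hard PRGs no natural
  property contains the slices of IQ3 infinitely often (`no_naturalProof_iqThree`).
* THE FACTORING-FREE CORE: the prime sub-language `bin {p prime, p ≡ 3 (4), 3 ∣ h(−p)}` equals
  `IQ3 ⊓ PRIMES` (`primeIqThreeLang_eq`), so a refutation of the crux also puts the prime
  sub-language in `P/poly` — unconditionally, by the tree's AKS theorem `PRIMES_mem_P'`, `P ⊆ P/poly`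
  and closure of `P/poly` under `⊓` (`primeIqThreeLang_mem_PPoly_of_not`). (Planner-facing: the crux
  is implied by the prime version, which bundles no squarefree recognition.)
-/

noncomputable section

namespace Summit.QuantumAdvantage.QuantumAdvantage.Theorems.IqThreeNotPPoly.Negative

open _root_.Computability Literature.Computability.Complexity Literature.Computability.Complexity.Classes
open Literature.Computability.Cryptography Literature.Computability.MetaComplexity
open Literature.Computability.QuantumComplexity (PRIMES PRIMES_mem_P')
open Literature.NumberTheory.QuadraticFields
open Summit.QuantumAdvantage.QuantumAdvantage.Theses.ArithStatLadder (IqThreeNotPPoly)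
open Filter

/-! ### Reading -/

/-! Throughout, `S = {d : ℕ | IsNegFundamentalDiscr d ∧ 3 ∣ h(−d)}` and `IQ3 = bin S =
encodingNatBool.toLanguage S` are written out verbatim (no auxiliary definitions in `Theorems/`). -/

/-- The crux is literally `IQ3 ∉ P/poly` (definitional unfolding; `IsNegFundamentalDiscr` of
`HallgrenClassGroup.lean` is verbatim the route file's inline disjunction). [folklore] -/
theorem iqThreeNotPPoly_iff : IqThreeNotPPoly ↔ (encodingNatBool.toLanguage {d : ℕ | IsNegFundamentalDiscr d ∧ 3 ∣ BinaryQuadraticForm.classNumber (-(d : ℤ))}) ∉ PPoly := Iff.rfl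

/-- A refutation is literally an explicit polynomial-size `B₂`-circuit family deciding `IQ3` on
every word. [folklore] -/
theorem not_iqThreeNotPPoly_iff_exists :
    ¬ IqThreeNotPPoly ↔ ∃ p : Polynomial ℕ, ∃ C : CircuitFamily,
      (∀ n, (C n).IsOver B2 ∧ (C n).size ≤ p.eval n) ∧ C.Decides (encodingNatBool.toLanguage {d : ℕ | IsNegFundamentalDiscr d ∧ 3 ∣ BinaryQuadraticForm.classNumber (-(d : ℤ))}) := by
  rw [iqThreeNotPPoly_iff, not_not]
  simp only [PPoly, SIZE, Set.mem_iUnion, Set.mem_setOf_eq]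

/-- Membership of an encoded number. [folklore] -/
theorem encodeNat_mem_iff (d : ℕ) : encodeNat d ∈ (encodingNatBool.toLanguage {d : ℕ | IsNegFundamentalDiscr d ∧ 3 ∣ BinaryQuadraticForm.classNumber (-(d : ℤ))}) ↔ d ∈ {d : ℕ | IsNegFundamentalDiscr d ∧ 3 ∣ BinaryQuadraticForm.classNumber (-(d : ℤ))} :=
  encodingNatBool.mem_toLanguage_iff {d : ℕ | IsNegFundamentalDiscr d ∧ 3 ∣ BinaryQuadraticForm.classNumber (-(d : ℤ))} d

/-! ### Small models at one input length -/

/-- `h(−19) = 1`. [folklore] -/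
theorem classNumber_neg_nineteen : BinaryQuadraticForm.classNumber (-19) = 1 := by decide

/-- `h(−31) = 3`. [folklore] -/
theorem classNumber_neg_thirtyone : BinaryQuadraticForm.classNumber (-31) = 3 := by decide

/-- A prime `p ≡ 3 (mod 4)` gives a fundamental discriminant `−p`. [folklore] -/
theorem isNegFundamentalDiscr_of_prime {p : ℕ} (hp : p.Prime) (h4 : p % 4 = 3) :
    IsNegFundamentalDiscr p := by
  left
  refine ⟨by omega, ?_, by omega⟩
  have h : Prime (-(p : ℤ)) := Int.prime_iff_natAbs_prime.2 (by simpa using hp)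
  exact h.squarefree

/-- `19 ∉ S` (`h(−19) = 1`). [folklore] -/
theorem nineteen_not_mem : 19 ∉ {d : ℕ | IsNegFundamentalDiscr d ∧ 3 ∣ BinaryQuadraticForm.classNumber (-(d : ℤ))} := by
  rintro ⟨-, h⟩
  rw [show (-(((19 : ℕ)) : ℤ)) = -19 by norm_num, classNumber_neg_nineteen] at h
  omega

/-- `31 ∈ S` (`31` is a prime `≡ 3 (mod 4)`, `h(−31) = 3`). [folklore] -/
theorem thirtyone_mem : 31 ∈ {d : ℕ | IsNegFundamentalDiscr d ∧ 3 ∣ BinaryQuadraticForm.classNumber (-(d : ℤ))} := by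
  refine ⟨isNegFundamentalDiscr_of_prime (by norm_num) (by norm_num), ?_⟩
  rw [show (-(((31 : ℕ)) : ℤ)) = -31 by norm_num, classNumber_neg_thirtyone]

/-- The length-5 slice of `IQ3` is non-constant (`bin 19 ∉`, `bin 31 ∈`, both of length 5), so no
constant-slice shortcut applies. [folklore] -/
theorem slice_five_nonconst :
    encodeNat 19 ∉ (encodingNatBool.toLanguage {d : ℕ | IsNegFundamentalDiscr d ∧ 3 ∣ BinaryQuadraticForm.classNumber (-(d : ℤ))}) ∧ encodeNat 31 ∈ (encodingNatBool.toLanguage {d : ℕ | IsNegFundamentalDiscr d ∧ 3 ∣ BinaryQuadraticForm.classNumber (-(d : ℤ))}) ∧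
      (encodeNat 19).length = 5 ∧ (encodeNat 31).length = 5 :=
  ⟨fun hm => nineteen_not_mem ((encodeNat_mem_iff 19).1 hm),
    (encodeNat_mem_iff 31).2 thirtyone_mem, by decide, by decide⟩

/-! ### Cost of the positive side -/

/-- The crux puts `IQ3` outside `BPP` (Adleman, tree theorem `BPP ⊆ P/poly`) — which is all the
route's deciding theorem consumes. [folklore] -/
theorem not_mem_BPP_of (h : IqThreeNotPPoly) : (encodingNatBool.toLanguage {d : ℕ | IsNegFundamentalDiscr d ∧ 3 ∣ BinaryQuadraticForm.classNumber (-(d : ℤ))}) ∉ BPP :=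
  fun hB => h (BPP_subset_PPoly_holds hB)

/-- The crux puts `IQ3` outside `P` (tree theorem `P ⊆ P/poly`). [folklore] -/
theorem not_mem_P_of (h : IqThreeNotPPoly) : (encodingNatBool.toLanguage {d : ℕ | IsNegFundamentalDiscr d ∧ 3 ∣ BinaryQuadraticForm.classNumber (-(d : ℤ))}) ∉ P :=
  fun hP => h (P_subset_PPoly_holds hP)

/-- With the folklore `IQ3 ∈ PSPACE` (not constructed in the tree) the crux separates `PSPACE`
from `P/poly`. [folklore] -/
theorem PSPACE_not_subset_PPoly_of (h : IqThreeNotPPoly) (hS : (encodingNatBool.toLanguage {d : ℕ | IsNegFundamentalDiscr d ∧ 3 ∣ BinaryQuadraticForm.classNumber (-(d : ℤ))}) ∈ PSPACE) :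
    ¬ PSPACE ⊆ PPoly :=
  fun hsub => h (hsub hS)

/-- Natural-proofs barrier at `IQ3`: under the Razborov–Rudich fact (catalogue entry
`Literature.Barriers.QuantumAdvantage.NaturalProofs`) and `2^{k^ε}`-hard PRGs in `P/poly`, no
natural property contains the slices of `IQ3` infinitely often. [folklore] -/
theorem no_naturalProof_iqThree (hRR : Literature.Barriers.QuantumAdvantage.NaturalProofs)
    (hG : Literature.Barriers.PneNP.HardPRGExist) :
    ¬ ∃ Q : CombinatorialProperty, Literature.Barriers.PneNP.IsNaturalProof Q ∧
      ∃ᶠ n in atTop, (encodingNatBool.toLanguage {d : ℕ | IsNegFundamentalDiscr d ∧ 3 ∣ BinaryQuadraticForm.classNumber (-(d : ℤ))}).sliceFn n ∈ Q n :=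
  Literature.Barriers.PneNP.NaturalProofs.no_naturalProof_for hRR hG (encodingNatBool.toLanguage {d : ℕ | IsNegFundamentalDiscr d ∧ 3 ∣ BinaryQuadraticForm.classNumber (-(d : ℤ))})

/-! ### The factoring-free core: the prime sub-language -/

/-- For a PRIME `p`, `−p` is fundamental iff `p ≡ 3 (mod 4)` (the `4 ∣ −p` branch is void).
[folklore] -/
theorem mod_four_of_isNegFundamentalDiscr_of_prime {p : ℕ} (hF : IsNegFundamentalDiscr p)
    (hp : p.Prime) : p % 4 = 3 := by
  rcases hF with ⟨h1, -, -⟩ | ⟨h4, -, -⟩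
  · omega
  · exfalso
    have h4' : (4 : ℕ) ∣ p := by exact_mod_cast (Int.dvd_neg.1 h4)
    rcases hp.eq_one_or_self_of_dvd 4 h4' with h | h
    · omega
    · subst h
      norm_num at hp

/-- The prime core `{p prime, p ≡ 3 (4), 3 ∣ h(−p)}` is `S ∩ {primes}`. [folklore] -/
theorem primeIqThreeSet_eq : {p : ℕ | p.Prime ∧ p % 4 = 3 ∧ 3 ∣ BinaryQuadraticForm.classNumber (-(p : ℤ))} = {d : ℕ | IsNegFundamentalDiscr d ∧ 3 ∣ BinaryQuadraticForm.classNumber (-(d : ℤ))} ∩ {p | p.Prime} := by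
  ext p
  constructor
  · rintro ⟨hp, h4, h3⟩
    exact ⟨⟨isNegFundamentalDiscr_of_prime hp h4, h3⟩, hp⟩
  · rintro ⟨⟨hF, h3⟩, hp⟩
    exact ⟨hp, mod_four_of_isNegFundamentalDiscr_of_prime hF hp, h3⟩

/-- `bin` commutes with intersections (injectivity of `encodeNat`). [folklore] -/
theorem toLanguage_inter (A B : Set ℕ) :
    encodingNatBool.toLanguage (A ∩ B) = encodingNatBool.toLanguage A ⊓ encodingNatBool.toLanguage B :=
  Set.image_inter encodingNatBool.encode_injective

/-- `bin` of the prime core is `IQ3 ⊓ PRIMES` (the tree's `PRIMES = bin {p | p.Prime}`). [folklore] -/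
theorem primeIqThreeLang_eq :
    encodingNatBool.toLanguage {p : ℕ | p.Prime ∧ p % 4 = 3 ∧ 3 ∣ BinaryQuadraticForm.classNumber (-(p : ℤ))} = (encodingNatBool.toLanguage {d : ℕ | IsNegFundamentalDiscr d ∧ 3 ∣ BinaryQuadraticForm.classNumber (-(d : ℤ))}) ⊓ PRIMES := by
  rw [primeIqThreeSet_eq, toLanguage_inter]
  rfl

/-- **A refutation of the crux puts the prime sub-language in `P/poly` too** — unconditionally:
`PRIMES ∈ P` (AKS, tree theorem `PRIMES_mem_P'`) `⊆ P/poly` (`P_subset_PPoly_holds`), and `P/poly`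
is closed under `⊓` (`inter_mem_PPoly`). Contrapositively, "`bin {p prime, p ≡ 3 (4), 3 ∣ h(−p)}
∉ P/poly`" implies the crux. [folklore] -/
theorem primeIqThreeLang_mem_PPoly_of_not (h : ¬ IqThreeNotPPoly) :
    encodingNatBool.toLanguage {p : ℕ | p.Prime ∧ p % 4 = 3 ∧ 3 ∣ BinaryQuadraticForm.classNumber (-(p : ℤ))} ∈ PPoly := by
  rw [primeIqThreeLang_eq]
  rw [iqThreeNotPPoly_iff, not_not] at h
  exact Literature.Computability.AlgebraicComplexity.inter_mem_PPoly h
    (P_subset_PPoly_holds PRIMES_mem_P')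

end Summit.QuantumAdvantage.QuantumAdvantage.Theorems.IqThreeNotPPoly.Negative

end
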